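import Literature.NumberTheory.GaloisRepresentations.MinkowskiUnits
import HarnessLib

/-!
# The relation lattice of a Minkowski family is non-trivial and of finite co-index (Prop. 5.10, input)

Topic `NumberTheory/GaloisRepresentations` (class field theory: the rank bookkeeping in
Childress, *Class Field Theory*, Ch. 4 §5 Prop. 5.10, PDF pp. 100–101, via Dirichlet's unit
theorem in Mathlib's form `NumberField.Units.exist_unique_eq_mul_prod`); namespace
`Literature.NumberTheory.GaloisRepresentations.MinkowskiUnit` (continuing
`MinkowskiUnits.lean`).  Everything **proved**.

For a Minkowski family `u` of `E/F` (`MinkowskiUnits.exists_family`):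

* `MinkowskiUnit.coord x : Fin (rank E) → ℤ` — the Dirichlet coordinates of a unit modulo torsion;
* **`MinkowskiUnit.relLattice_ne_bot`** — the relation lattice `K` of `u` is non-trivial
  (`#S_∞ = rank + 1` integer vectors in `ℤ^{rank}` are dependent);
* **`MinkowskiUnit.exists_pow_mem_realRange_sup_torsionE`** — every global unit has a power in
  `⟨u_w⟩ · μ(E)`;
* **`MinkowskiUnit.relIndex_realRange_sup_torsionE_ne_zero`** — hence
  `[𝒪_Eˣ : ⟨u_w⟩ · μ(E)] < ∞` (reduction of the Dirichlet coordinates modulo a common exponent).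

## References

* N. Childress, *Class Field Theory*, Universitext, Springer 2009, Ch. 4 §5 Prop. 5.10
  (PDF pp. 100–101). [Childress2009]
-/

noncomputable section

open NumberField NumberField.InfinitePlace NumberField.Units NumberField.Units.dirichletUnitTheorem

namespace Literature.NumberTheory.GaloisRepresentations

namespace MinkowskiUnit

open PermLattice PermLattice.PermMod

variable {F : Type*} [Field F] {E : Type*} [Field E] [Algebra F E] [NumberField E]

/-! ### Dirichlet coordinates -/

/-- The Dirichlet coordinates of a unit modulo torsion: the exponents in Mathlib's unique
decomposition `x = ζ · ∏ᵢ εᵢ ^ eᵢ` (`NumberField.Units.exist_unique_eq_mul_prod`). [folklore] -/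
def coord (x : (𝓞 E)ˣ) : Fin (rank E) → ℤ := (exist_unique_eq_mul_prod E x).exists.choose.2

/-- **Dirichlet**: `x = ζ · ∏ᵢ εᵢ ^ coord x i` for a root of unity `ζ`. [folklore] -/
theorem exists_eq_torsion_mul_prod (x : (𝓞 E)ˣ) :
    ∃ ζ ∈ torsion E, x = ζ * ∏ i, fundSystem E i ^ coord x i :=
  ⟨_, (exist_unique_eq_mul_prod E x).exists.choose.1.2, (exist_unique_eq_mul_prod E x).exists.choose_spec⟩

/-- Uniqueness of the Dirichlet coordinates. [folklore] -/
theorem coord_unique {x ζ : (𝓞 E)ˣ} (hζ : ζ ∈ torsion E) {e : Fin (rank E) → ℤ}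
    (h : x = ζ * ∏ i, fundSystem E i ^ e i) : e = coord x := by
  obtain ⟨ζ₀, hζ₀, h₀⟩ := exists_eq_torsion_mul_prod x
  have := (exist_unique_eq_mul_prod E x).unique (y₁ := (⟨ζ, hζ⟩, e)) (y₂ := (⟨ζ₀, hζ₀⟩, coord x)) h h₀
  exact congrArg Prod.snd this

/-- `coord (x y) = coord x + coord y`. [folklore] -/
theorem coord_mul (x y : (𝓞 E)ˣ) (i : Fin (rank E)) : coord (x * y) i = coord x i + coord y i := by
  obtain ⟨ζ₁, hζ₁, h₁⟩ := exists_eq_torsion_mul_prod x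
  obtain ⟨ζ₂, hζ₂, h₂⟩ := exists_eq_torsion_mul_prod y
  have h : x * y = (ζ₁ * ζ₂) * ∏ i, fundSystem E i ^ (coord x i + coord y i) := by
    conv_lhs => rw [h₁, h₂]
    rw [mul_mul_mul_comm, ← Finset.prod_mul_distrib]
    congr 1
    exact Finset.prod_congr rfl fun i _ => (zpow_add _ _ _).symm
  exact (congrFun (coord_unique ((torsion E).mul_mem hζ₁ hζ₂) h) i).symm

/-- `coord 1 = 0`. [folklore] -/
theorem coord_one (i : Fin (rank E)) : coord (1 : (𝓞 E)ˣ) i = 0 := by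
  have h : (1 : (𝓞 E)ˣ) = 1 * ∏ i, fundSystem E i ^ (0 : Fin (rank E) → ℤ) i := by simp
  exact (congrFun (coord_unique (torsion E).one_mem h) i).symm

/-- `coord (x ^ k) = k · coord x`. [folklore] -/
theorem coord_zpow (x : (𝓞 E)ˣ) (k : ℤ) (i : Fin (rank E)) : coord (x ^ k) i = k * coord x i := by
  obtain ⟨ζ, hζ, hx⟩ := exists_eq_torsion_mul_prod x
  have h : x ^ k = ζ ^ k * ∏ i, fundSystem E i ^ (k * coord x i) := by
    conv_lhs => rw [hx]
    rw [mul_zpow, ← Finset.prod_zpow]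
    congr 1
    exact Finset.prod_congr rfl fun i _ => by rw [← zpow_mul, mul_comm]
  exact (congrFun (coord_unique ((torsion E).zpow_mem hζ k) h) i).symm

/-- `coord (∏ xⱼ) = ∑ coord xⱼ`. [folklore] -/
theorem coord_prod {ι : Type*} (s : Finset ι) (x : ι → (𝓞 E)ˣ) (i : Fin (rank E)) :
    coord (∏ j ∈ s, x j) i = ∑ j ∈ s, coord (x j) i := by
  classical
  induction s using Finset.induction_on with
  | empty => rw [Finset.prod_empty, Finset.sum_empty, coord_one]
  | insert a s ha ih => rw [Finset.prod_insert ha, Finset.sum_insert ha, coord_mul, ih]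

/-- A unit with zero Dirichlet coordinates is a root of unity. [folklore] -/
theorem mem_torsion_of_coord_eq_zero {x : (𝓞 E)ˣ} (h : ∀ i, coord x i = 0) : x ∈ torsion E := by
  obtain ⟨ζ, hζ, hx⟩ := exists_eq_torsion_mul_prod x
  rw [hx, Finset.prod_eq_one fun i _ => by rw [h i, zpow_zero], mul_one]
  exact hζ

/-- `#S_∞(E) = rank E + 1`. [folklore] -/
theorem card_infinitePlace_eq : Fintype.card (InfinitePlace E) = rank E + 1 := by
  rw [rank, Nat.sub_add_cancel Fintype.card_pos]

/-- Clearing denominators of finitely many rationals. [folklore] -/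
theorem exists_int_mul_eq {ι : Type*} [Fintype ι] (g : ι → ℚ) :
    ∃ b : ℤ, b ≠ 0 ∧ ∃ m : ι → ℤ, ∀ i, (m i : ℚ) = b * g i := by
  classical
  refine ⟨∏ i, ((g i).den : ℤ), ?_, fun i => (g i).num * ∏ j ∈ Finset.univ.erase i, ((g j).den : ℤ), fun i => ?_⟩
  · exact Finset.prod_ne_zero_iff.mpr fun i _ => by exact_mod_cast (g i).den_nz
  · rw [← Finset.mul_prod_erase _ _ (Finset.mem_univ i)]
    push_cast
    rw [← Rat.mul_den_eq_num (g i)]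
    ring

variable {u : InfinitePlace E → Eˣ}
  (hu₁ : ∀ w, u w ∈ unitsE E)
  (hu₃ : ∀ w w' : InfinitePlace E, w' ≠ w → Real.log (w' (u w : E)) < 0)

omit [NumberField E] in
/-- A global unit family has integral preimages. [folklore] -/
theorem exists_preimage (hu₁ : ∀ w, u w ∈ unitsE E) :
    ∃ x : InfinitePlace E → (𝓞 E)ˣ, ∀ w, Units.map (algebraMap (𝓞 E) E : 𝓞 E →* E) (x w) = u w := by
  choose x hx using hu₁; exact ⟨x, hx⟩

/-- An integer vector `m` with `∑_w m_w coord(x_w) = 0` is a relation. [folklore] -/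
theorem mk_mem_relLattice {x : InfinitePlace E → (𝓞 E)ˣ}
    (hx : ∀ w, Units.map (algebraMap (𝓞 E) E : 𝓞 E →* E) (x w) = u w) {m : InfinitePlace E → ℤ}
    (hm : ∀ i, ∑ w, m w * coord (x w) i = 0) : PermMod.mk m ∈ relLattice u := by
  rw [relLattice, Subgroup.mem_comap, mem_torsionE_iff_exists]
  refine ⟨∏ w, x w ^ m w, mem_torsion_of_coord_eq_zero fun i => ?_, ?_⟩
  · rw [coord_prod]; simp_rw [coord_zpow]; exact hm i
  · rw [map_prod, real_apply]
    exact Finset.prod_congr rfl fun w _ => by rw [map_zpow, hx, val_mk]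

include hu₁ in
/-- **The relation lattice is non-trivial**: the `rank + 1` coordinate vectors of the `u_w` in
`ℤ^{rank}` are linearly dependent. [cite: Childress2009, Ch. 4 §5 Prop. 5.10 (proof) (PDF p. 101)] -/
theorem relLattice_ne_bot : relLattice u ≠ ⊥ := by
  classical
  obtain ⟨x, hx⟩ := exists_preimage hu₁
  set v : InfinitePlace E → (Fin (rank E) → ℚ) := fun w i => (coord (x w) i : ℚ) with hv
  have hdep : ¬ LinearIndependent ℚ v := fun h => by
    have := h.fintype_card_le_finrank
    rw [Module.finrank_fin_fun, card_infinitePlace_eq] at this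
    omega
  obtain ⟨g, hg, w₁, hw₁⟩ := Fintype.not_linearIndependent_iff.mp hdep
  obtain ⟨b, hb, m, hm⟩ := exists_int_mul_eq g
  have hrel : PermMod.mk m ∈ relLattice u := by
    refine mk_mem_relLattice hx fun i => ?_
    have hgi := congrFun hg i
    simp only [Finset.sum_apply, Pi.smul_apply, smul_eq_mul, Pi.zero_apply] at hgi
    have : (∑ w, m w * coord (x w) i : ℚ) = b * ∑ w, g w * (coord (x w) i : ℚ) := by
      rw [Finset.mul_sum]; exact Finset.sum_congr rfl fun w _ => by rw [hm w]; ring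
    rw [hgi, mul_zero] at this
    exact_mod_cast this
  intro hbot
  rw [hbot, Subgroup.mem_bot] at hrel
  have := congrArg (fun f : PermMod (InfinitePlace E) => f.val w₁) hrel
  simp only [val_mk, val_one] at this
  have h2 : (m w₁ : ℚ) = 0 := by exact_mod_cast this
  rw [hm w₁, mul_eq_zero] at h2
  rcases h2 with h2 | h2
  · exact hb (by exact_mod_cast h2)
  · exact hw₁ h2

include hu₁ hu₃ in
/-- **Every global unit has a power in `⟨u_w⟩ · μ(E)`** (the coordinate vectors of any `rank` of
the `u_w` together with that of `x` are dependent, and a relation among the `u_w` alone vanishing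
at one place vanishes). [cite: Childress2009, Ch. 4 §5 Prop. 5.10 (proof) (PDF p. 101)] -/
theorem exists_pow_mem_realRange_sup_torsionE (y : (𝓞 E)ˣ) :
    ∃ b : ℤ, b ≠ 0 ∧ Units.map (algebraMap (𝓞 E) E : 𝓞 E →* E) y ^ b ∈ (real u).range ⊔ torsionE E := by
  classical
  obtain ⟨x, hx⟩ := exists_preimage hu₁
  obtain ⟨w₁⟩ := (inferInstance : Nonempty (InfinitePlace E))
  -- replace the vector at `w₁` by that of `y`
  set V : InfinitePlace E → (Fin (rank E) → ℚ) := fun w i =>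
    if w = w₁ then (coord y i : ℚ) else (coord (x w) i : ℚ) with hV
  have hdep : ¬ LinearIndependent ℚ V := fun h => by
    have := h.fintype_card_le_finrank
    rw [Module.finrank_fin_fun, card_infinitePlace_eq] at this
    omega
  obtain ⟨g, hg, w₂, hw₂⟩ := Fintype.not_linearIndependent_iff.mp hdep
  obtain ⟨b, hb, m, hm⟩ := exists_int_mul_eq g
  have hgi : ∀ i, (m w₁ : ℚ) * coord y i + ∑ w ∈ Finset.univ.erase w₁, (m w : ℚ) * coord (x w) i = 0 := by
    intro i
    have h := congrFun hg i
    simp only [Finset.sum_apply, Pi.smul_apply, smul_eq_mul, Pi.zero_apply] at h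
    rw [← Finset.add_sum_erase _ _ (Finset.mem_univ w₁)] at h
    simp only [hV, if_pos rfl] at h
    have h' : g w₁ * (coord y i : ℚ) + ∑ w ∈ Finset.univ.erase w₁, g w * (coord (x w) i : ℚ) = 0 := by
      rw [← h]; congr 1
      exact Finset.sum_congr rfl fun w hw => by rw [if_neg (Finset.ne_of_mem_erase hw)]
    have := congrArg (fun t => (b : ℚ) * t) h'
    simp only [mul_add, Finset.mul_sum, mul_zero] at this
    rw [← this]; congr 1
    · rw [hm]; ring
    · exact Finset.sum_congr rfl fun w _ => by rw [hm]; ring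
  -- the coefficient at `w₁` is non-zero
  have hm₁ : m w₁ ≠ 0 := by
    intro h0
    -- then `m` restricted off `w₁` is a relation vanishing at `w₁`
    set m' : InfinitePlace E → ℤ := fun w => if w = w₁ then 0 else m w with hm'
    have hrel : PermMod.mk m' ∈ relLattice u := by
      refine mk_mem_relLattice hx fun i => ?_
      have h := hgi i
      rw [h0, Int.cast_zero, zero_mul, zero_add] at h
      rw [← Finset.add_sum_erase _ _ (Finset.mem_univ w₁)]
      simp only [hm', if_pos rfl, zero_mul, zero_add]
      have : (∑ w ∈ Finset.univ.erase w₁, m' w * coord (x w) i : ℚ) = 0 := by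
        rw [← h]
        exact Finset.sum_congr rfl fun w hw => by
          simp only [hm', if_neg (Finset.ne_of_mem_erase hw)]
      exact_mod_cast this
    have h1 : PermMod.mk m' = 1 :=
      eq_one_of_mem_relLattice_of_val_eq_zero hu₁ hu₃ hrel (w₀ := w₁) (by simp only [val_mk, hm']; rfl)
    -- hence all `g w = 0`
    apply hw₂
    by_cases h21 : w₂ = w₁
    · rw [h21]
      have : (m w₁ : ℚ) = 0 := by exact_mod_cast h0
      rw [hm w₁, mul_eq_zero] at this
      exact this.resolve_left (by exact_mod_cast hb)
    · have := congrArg (fun f : PermMod (InfinitePlace E) => f.val w₂) h1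
      simp only [val_mk, val_one, hm', if_neg h21] at this
      have h2 : (m w₂ : ℚ) = 0 := by exact_mod_cast this
      rw [hm w₂, mul_eq_zero] at h2
      exact h2.resolve_left (by exact_mod_cast hb)
  -- `y ^ (m w₁) · ∏_{w ≠ w₁} x_w ^ (m w)` is torsion
  set z : (𝓞 E)ˣ := y ^ m w₁ * ∏ w ∈ Finset.univ.erase w₁, x w ^ m w with hz
  have hztors : z ∈ torsion E := mem_torsion_of_coord_eq_zero fun i => by
    rw [hz, coord_mul, coord_zpow, coord_prod]
    simp_rw [coord_zpow]
    exact_mod_cast hgi i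
  refine ⟨m w₁, hm₁, ?_⟩
  have hy : Units.map (algebraMap (𝓞 E) E : 𝓞 E →* E) y ^ m w₁ =
      Units.map (algebraMap (𝓞 E) E : 𝓞 E →* E) z *
        (∏ w ∈ Finset.univ.erase w₁, u w ^ m w)⁻¹ := by
    rw [hz, map_mul, map_zpow, map_prod]
    simp_rw [map_zpow, hx]
    rw [mul_inv_cancel_right]
  rw [hy]
  refine Subgroup.mul_mem _ (Subgroup.mem_sup_right (mem_torsionE_iff_exists.mpr ⟨z, hztors, rfl⟩))
    (Subgroup.mem_sup_left (Subgroup.inv_mem _ (Subgroup.prod_mem _ fun w _ => ?_)))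
  exact Subgroup.zpow_mem _ (show u w ∈ (real u).range from ⟨single w, real_single u w⟩) _

/-! ### Finite co-index -/

/-- The reduction of the Dirichlet coordinates modulo `D`, as a homomorphism. [folklore] -/
def coordMod (D : ℕ) : (𝓞 E)ˣ →* Multiplicative (Fin (rank E) → ZMod D) where
  toFun x := Multiplicative.ofAdd fun i => ((coord x i : ℤ) : ZMod D)
  map_one' := by
    apply Multiplicative.toAdd.injective
    funext i; simp [coord_one]
  map_mul' x y := by
    apply Multiplicative.toAdd.injective
    funext i; simp [coord_mul]

/-- The kernel of `coordMod D`: coordinates divisible by `D`. [folklore] -/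
theorem mem_ker_coordMod_iff {D : ℕ} {x : (𝓞 E)ˣ} : x ∈ (coordMod D).ker ↔ ∀ i, (D : ℤ) ∣ coord x i := by
  rw [MonoidHom.mem_ker]
  constructor
  · intro h i
    have := congrFun (congrArg Multiplicative.toAdd h) i
    simp only [coordMod, MonoidHom.coe_mk, OneHom.coe_mk, toAdd_ofAdd, toAdd_one] at this
    exact (ZMod.intCast_zmod_eq_zero_iff_dvd _ _).mp this
  · intro h
    apply Multiplicative.toAdd.injective
    funext i
    simp only [coordMod, MonoidHom.coe_mk, OneHom.coe_mk, toAdd_ofAdd, toAdd_one]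
    exact (ZMod.intCast_zmod_eq_zero_iff_dvd _ _).mpr (h i)

include hu₁ hu₃ in
/-- **`[𝒪_Eˣ : ⟨u_w⟩ · μ(E)] < ∞`** for a Minkowski family.
[cite: Childress2009, Ch. 4 §5 Prop. 5.10 (proof) (PDF p. 101)] -/
theorem relIndex_realRange_sup_torsionE_ne_zero :
    ((real u).range ⊔ torsionE E).relIndex (unitsE E) ≠ 0 := by
  classical
  set U' := (real u).range ⊔ torsionE E with hU'
  set mapU : (𝓞 E)ˣ →* Eˣ := Units.map (algebraMap (𝓞 E) E : 𝓞 E →* E) with hmapU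
  -- a common exponent for the fundamental units
  have hb : ∀ i : Fin (rank E), ∃ b : ℕ, 0 < b ∧ mapU (fundSystem E i) ^ b ∈ U' := fun i => by
    obtain ⟨b, hb, hmem⟩ := exists_pow_mem_realRange_sup_torsionE hu₁ hu₃ (fundSystem E i)
    refine ⟨b.natAbs, Int.natAbs_pos.mpr hb, ?_⟩
    rcases Int.natAbs_eq b with h | h
    · rw [← zpow_natCast, ← h]; exact hmem
    · rw [← zpow_natCast, show ((b.natAbs : ℕ) : ℤ) = -b by omega, zpow_neg]
      exact Subgroup.inv_mem _ hmem
  choose b hbpos hbmem using hb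
  set D : ℕ := ∏ i, b i with hD
  have hDpos : 0 < D := Finset.prod_pos fun i _ => hbpos i
  haveI : NeZero D := ⟨hDpos.ne'⟩
  have hDmem : ∀ i, mapU (fundSystem E i) ^ (D : ℤ) ∈ U' := fun i => by
    obtain ⟨c, hc⟩ : b i ∣ D := Finset.dvd_prod_of_mem _ (Finset.mem_univ i)
    rw [hc, Nat.cast_mul, zpow_mul, zpow_natCast, zpow_natCast]
    exact Subgroup.pow_mem _ (hbmem i) _
  -- the kernel of the reduction mod `D` lands in `U'`
  have hker : (coordMod D).ker ≤ U'.comap mapU := by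
    intro x hx
    rw [mem_ker_coordMod_iff] at hx
    choose c hc using hx
    obtain ⟨ζ, hζ, hxeq⟩ := exists_eq_torsion_mul_prod x
    rw [Subgroup.mem_comap, hxeq, map_mul, map_prod]
    refine Subgroup.mul_mem _ (Subgroup.mem_sup_right (mem_torsionE_iff_exists.mpr ⟨ζ, hζ, rfl⟩))
      (Subgroup.prod_mem _ fun i _ => ?_)
    rw [map_zpow, hc i, zpow_mul]
    exact Subgroup.zpow_mem _ (hDmem i) _
  -- indices
  have hindex : (U'.comap mapU).index ≠ 0 := by
    intro h0
    have hdvd := Subgroup.index_dvd_of_le hker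
    rw [h0, Nat.zero_dvd, Subgroup.index_ker] at hdvd
    exact (Nat.card_pos (α := (coordMod (E := E) D).range)).ne' hdvd
  have hrange : (⊤ : Subgroup (𝓞 E)ˣ).map mapU = unitsE E := by rw [← MonoidHom.range_eq_map]; rfl
  rwa [← hrange, ← Subgroup.relIndex_comap, Subgroup.relIndex_top_right]

end MinkowskiUnit

end Literature.NumberTheory.GaloisRepresentations
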